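import Mathlib.NumberTheory.AbelSummation
import Mathlib.Analysis.SpecialFunctions.ImproperIntegrals
import Mathlib.Analysis.SpecialFunctions.Integrals.Basic
import Mathlib.Analysis.SpecialFunctions.Pow.Deriv
import HarnessLib

/-!
# Power-law Abel summation: `∑_{k ≤ T} c_k k^{−λ}` from `∑_{k ≤ t} c_k = b t^ρ + O(t^τ)`

Topic `Literature/NumberTheory/BeurlingPrimes`. Everything in this file is PROVED. These are the three
partial-summation estimates used in the proof of the hyperbola lemma of Broucke–Debruyne–Révész
(arXiv:2309.01567, Lemma 5.1, p. 14: "The first term delivers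
`∑_{n ≤ y} L(x/n) = b x^β ∑_{n ≤ y} n^{−β} + x^δ ∑_{n ≤ y} O(n^{−δ}) = b x^β I(β) + ab x^β y^{1−β}/(1−β) +
O(x^β y^{γ−β}) + O(x^δ y^{1−δ})`. The second term gives `ax ∑_{l ≤ x/y} h(l)/l + … = axH(1) −
βab x^β y^{1−β}/(1−β) + …`"), isolated as statements about a real sequence `c` (with `c 0 = 0`) and
its summatory function `A(t) = ∑_{k ≤ t} c_k` (`partialSum`):

* `sum_mul_rpow_neg_eq` — Abel summation with `f(t) = t^{−λ}` (Mathlib's `sum_mul_eq_sub_integral_mul₀`):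
  `∑_{k ≤ T} c_k k^{−λ} = A(T) T^{−λ} + λ ∫₁ᵀ A(t) t^{−λ−1} dt`.
* `sum_mul_rpow_neg_le` — if `c ≥ 0` and `A(t) ≤ B t^ρ` (`t ≥ 1`), `0 ≤ λ < ρ`, then
  `∑_{k ≤ T} c_k k^{−λ} ≤ B ρ/(ρ−λ) · T^{ρ−λ}`.
* `abs_sum_mul_rpow_neg_sub_le` — if `|A(t) − a t| ≤ B t^τ` (`t ≥ 1`), `0 ≤ τ < λ < 1`, then
  `|∑_{k ≤ T} c_k k^{−λ} − (a/(1−λ) T^{1−λ} + I)| ≤ B (1 + λ/(λ−τ)) T^{τ−λ}` with the constant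
  `I = abelConst c a λ = λ ∫₁^∞ (A(t) − at) t^{−λ−1} dt − aλ/(1−λ)` (BDR's `I(β)`), and the limit form
  `tendsto_sum_mul_rpow_neg_sub`.
* `hasSum_mul_rpow_neg`, `abs_tail_sub_le` — if `c ≥ 0`, `|A(t) − b t^ρ| ≤ B t^τ` (`t ≥ 1`),
  `0 ≤ τ < ρ < λ`, then `∑_k c_k k^{−λ}` converges to `λ ∫₁^∞ A(t) t^{−λ−1} dt` and its tail beyond
  `T` is `bρ/(λ−ρ) T^{ρ−λ}` up to `B (1 + λ/(λ−τ)) T^{τ−λ}`.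

## References
* [BrouckeDebruyneRevesz2023] F. Broucke, G. Debruyne, Sz. Gy. Révész, *Some examples of well-behaved
  Beurling number systems*, arXiv:2309.01567 (Trans. AMS 2024), Lemma 5.1 and its proof, p. 14 (read).
-/

noncomputable section

open Filter MeasureTheory Set
open scoped Topology

namespace Literature.NumberTheory.BeurlingPrimes

variable (c : ℕ → ℝ)

/-- The summatory function `A(t) = ∑_{0 ≤ k ≤ ⌊t⌋} c_k` (Mathlib's Abel-summation normal form). [folklore] -/
abbrev partialSum (t : ℝ) : ℝ := ∑ k ∈ Finset.Icc 0 ⌊t⌋₊, c k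

/-! ### Small analytic helpers -/

/-- `t ↦ t^r` is continuous on a set of positive reals. [folklore] -/
theorem continuousOn_rpow_const_of_pos (r : ℝ) {s : Set ℝ} (hs : ∀ t ∈ s, (0 : ℝ) < t) :
    ContinuousOn (fun t : ℝ ↦ t ^ r) s :=
  continuousOn_id.rpow_const fun t ht ↦ Or.inl (hs t ht).ne'

/-- `t ↦ K t^r` is continuous on a set of positive reals. [folklore] -/
theorem continuousOn_const_mul_rpow_of_pos (K r : ℝ) {s : Set ℝ} (hs : ∀ t ∈ s, (0 : ℝ) < t) :
    ContinuousOn (fun t : ℝ ↦ K * t ^ r) s :=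
  continuousOn_const.mul (continuousOn_rpow_const_of_pos r hs)

/-- Points of `[1, T]` are positive. [folklore] -/
theorem pos_of_mem_Icc_one {T t : ℝ} (ht : t ∈ Icc (1 : ℝ) T) : (0 : ℝ) < t :=
  lt_of_lt_of_le one_pos ht.1

/-- Points of `[1, ∞)` are positive. [folklore] -/
theorem pos_of_mem_Ici_one {t : ℝ} (ht : t ∈ Ici (1 : ℝ)) : (0 : ℝ) < t :=
  lt_of_lt_of_le one_pos (Set.mem_Ici.mp ht)

/-- `t ↦ t^{a}` is integrable at `+∞` for `a < −1`. [folklore] -/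
theorem integrableAtFilter_rpow_atTop {a : ℝ} (ha : a < -1) :
    IntegrableAtFilter (fun t : ℝ ↦ t ^ a) atTop :=
  ⟨Ioi 1, Ioi_mem_atTop 1, integrableOn_Ioi_rpow_of_lt ha one_pos⟩

/-- `∫_{(1,T]} t^r dt = (T^{r+1} − 1)/(r+1)` for `r > −1`, `T ≥ 1`. [folklore] -/
theorem integral_Ioc_one_rpow {r T : ℝ} (hr : -1 < r) (hT : 1 ≤ T) :
    ∫ t in Ioc 1 T, t ^ r = (T ^ (r + 1) - 1) / (r + 1) := by
  rw [← intervalIntegral.integral_of_le hT, integral_rpow (Or.inl hr), Real.one_rpow]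

/-! ### Abel summation against `t^{−λ}` -/

/-- The derivative of `t ↦ t^{−λ}`. [folklore] -/
theorem deriv_rpow_neg (l : ℝ) : deriv (fun t : ℝ ↦ t ^ (-l)) = fun t ↦ -l * t ^ (-l - 1) := by
  funext t; exact Real.deriv_rpow_const t (-l)

/-- **Abel summation with `f(t) = t^{−λ}`**: for `c 0 = 0` (and any real `T`; both sides vanish for `T < 1`),
`∑_{k ≤ T} c_k k^{−λ} = A(T) T^{−λ} + λ ∫_{(1,T]} A(t) t^{−λ−1} dt`. [folklore] -/
theorem sum_mul_rpow_neg_eq (hc : c 0 = 0) (l T : ℝ) :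
    ∑ k ∈ Finset.Icc 0 ⌊T⌋₊, c k * (k : ℝ) ^ (-l) =
      partialSum c T * T ^ (-l) + l * ∫ t in Ioc 1 T, partialSum c t * t ^ (-l - 1) := by
  have hf_diff : ∀ t ∈ Icc 1 T, DifferentiableAt ℝ (fun t : ℝ ↦ t ^ (-l)) t := fun t ht ↦
    (Real.hasDerivAt_rpow_const (Or.inl (pos_of_mem_Icc_one ht).ne')).differentiableAt
  have hf_int : IntegrableOn (deriv (fun t : ℝ ↦ t ^ (-l))) (Icc 1 T) := by
    rw [deriv_rpow_neg]
    exact (continuousOn_const_mul_rpow_of_pos (-l) (-l - 1) fun t ht ↦ pos_of_mem_Icc_one ht).integrableOn_Icc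
  have h := sum_mul_eq_sub_integral_mul₀ c hc T hf_diff hf_int
  simp only [deriv_rpow_neg] at h
  have h2 : ∫ t in Ioc 1 T, -l * t ^ (-l - 1) * partialSum c t =
      -l * ∫ t in Ioc 1 T, partialSum c t * t ^ (-l - 1) := by
    rw [← integral_const_mul]
    refine setIntegral_congr_fun measurableSet_Ioc fun t _ ↦ by ring
  calc ∑ k ∈ Finset.Icc 0 ⌊T⌋₊, c k * (k : ℝ) ^ (-l)
      = ∑ k ∈ Finset.Icc 0 ⌊T⌋₊, (k : ℝ) ^ (-l) * c k := Finset.sum_congr rfl fun k _ ↦ mul_comm _ _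
    _ = _ := h
    _ = _ := by rw [h2]; ring

/-! ### Integrability of `A(t) t^{r}` and of the error term -/

/-- `A(t) t^r` is integrable on `(1, T]`. [folklore] -/
theorem integrableOn_partialSum_mul_rpow_Ioc (r : ℝ) (T : ℝ) :
    IntegrableOn (fun t : ℝ ↦ partialSum c t * t ^ r) (Ioc 1 T) := by
  have hg : IntegrableOn (fun t : ℝ ↦ t ^ r) (Icc 1 T) :=
    (continuousOn_rpow_const_of_pos r fun t ht ↦ pos_of_mem_Icc_one ht).integrableOn_Icc
  have h := integrableOn_mul_sum_Icc c zero_le_one (m := 0) hg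
  exact (h.mono_set Ioc_subset_Icc_self).congr_fun (fun t _ ↦ mul_comm _ _) measurableSet_Ioc

/-- `t ↦ t^{r} A(t)` is locally integrable on `[1, ∞)`. [folklore] -/
theorem locallyIntegrableOn_rpow_mul_partialSum (r : ℝ) :
    LocallyIntegrableOn (fun t : ℝ ↦ t ^ r * partialSum c t) (Ici 1) :=
  locallyIntegrableOn_mul_sum_Icc c zero_le_one
    ((continuousOn_rpow_const_of_pos r fun _ ht ↦ pos_of_mem_Ici_one ht).locallyIntegrableOn measurableSet_Ici)

/-- If `|A(t) − b t^ρ| ≤ B t^τ` on `[1, ∞)` and `τ < λ`, then the error term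
`(A(t) − b t^ρ) t^{−λ−1}` is integrable on `(1, ∞)`. [folklore] -/
theorem integrableOn_error_mul_rpow {b ρ τ l B : ℝ} (hτl : τ < l)
    (hA : ∀ t, 1 ≤ t → |partialSum c t - b * t ^ ρ| ≤ B * t ^ τ) :
    IntegrableOn (fun t : ℝ ↦ (partialSum c t - b * t ^ ρ) * t ^ (-l - 1)) (Ioi 1) := by
  have hloc : LocallyIntegrableOn (fun t : ℝ ↦ (partialSum c t - b * t ^ ρ) * t ^ (-l - 1)) (Ici 1) := by
    have h1 := locallyIntegrableOn_rpow_mul_partialSum c (-l - 1)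
    have h2 : LocallyIntegrableOn (fun t : ℝ ↦ b * t ^ ρ * t ^ (-l - 1)) (Ici 1) := by
      refine ContinuousOn.locallyIntegrableOn ?_ measurableSet_Ici
      exact (continuousOn_const_mul_rpow_of_pos b ρ fun _ ht ↦ pos_of_mem_Ici_one ht).mul
        (continuousOn_rpow_const_of_pos _ fun _ ht ↦ pos_of_mem_Ici_one ht)
    have hfun : (fun t : ℝ ↦ (partialSum c t - b * t ^ ρ) * t ^ (-l - 1)) =
        (fun t : ℝ ↦ t ^ (-l - 1) * partialSum c t) - fun t : ℝ ↦ b * t ^ ρ * t ^ (-l - 1) := by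
      funext t; simp only [Pi.sub_apply]; ring
    rw [hfun]
    exact h1.sub h2
  have hbigO : (fun t : ℝ ↦ (partialSum c t - b * t ^ ρ) * t ^ (-l - 1)) =O[atTop] fun t : ℝ ↦ t ^ (τ - l - 1) := by
    refine Asymptotics.IsBigO.of_bound |B| ?_
    filter_upwards [eventually_ge_atTop (1 : ℝ)] with t ht
    have ht0 : 0 < t := by linarith
    rw [Real.norm_eq_abs, Real.norm_eq_abs, abs_mul, abs_of_nonneg (Real.rpow_nonneg ht0.le _),
      abs_of_nonneg (Real.rpow_nonneg ht0.le _)]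
    calc |partialSum c t - b * t ^ ρ| * t ^ (-l - 1) ≤ B * t ^ τ * t ^ (-l - 1) :=
          mul_le_mul_of_nonneg_right (hA t ht) (Real.rpow_nonneg ht0.le _)
      _ ≤ |B| * t ^ τ * t ^ (-l - 1) := by gcongr; exact le_abs_self B
      _ = |B| * t ^ (τ - l - 1) := by
          rw [show τ - l - 1 = τ + (-l - 1) by ring, Real.rpow_add ht0]; ring
  have hint := hloc.integrableOn_of_isBigO_atTop hbigO (integrableAtFilter_rpow_atTop (by linarith))
  exact hint.mono_set Ioi_subset_Ici_self

/-- If `|A(t)| ≤ K t^ρ` on `[1, ∞)` and `ρ < λ`, then `A(t) t^{−λ−1}` is integrable on `(1, ∞)`. [folklore] -/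
theorem integrableOn_partialSum_mul_rpow {ρ l K : ℝ} (hρl : ρ < l)
    (hA : ∀ t, 1 ≤ t → |partialSum c t| ≤ K * t ^ ρ) :
    IntegrableOn (fun t : ℝ ↦ partialSum c t * t ^ (-l - 1)) (Ioi 1) := by
  have h := integrableOn_error_mul_rpow c (b := 0) (ρ := ρ) hρl (B := K) (fun t ht ↦ by simpa using hA t ht)
  simpa using h

/-- `|∫_{(T,∞)} E(t) t^{−λ−1} dt| ≤ B T^{τ−λ}/(λ−τ)` when `|E(t)| ≤ B t^τ` (`t ≥ 1`), `τ < λ`, `T ≥ 1`.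
[folklore] -/
theorem abs_integral_Ioi_error_le {b ρ τ l B : ℝ} (hτl : τ < l)
    (hA : ∀ t, 1 ≤ t → |partialSum c t - b * t ^ ρ| ≤ B * t ^ τ) {T : ℝ} (hT : 1 ≤ T) :
    |∫ t in Ioi T, (partialSum c t - b * t ^ ρ) * t ^ (-l - 1)| ≤ B * T ^ (τ - l) / (l - τ) := by
  have hT0 : 0 < T := by linarith
  have hbound : ∀ t ∈ Ioi T, ‖(partialSum c t - b * t ^ ρ) * t ^ (-l - 1)‖ ≤ B * t ^ (τ - l - 1) := by
    intro t ht
    have ht1 : 1 ≤ t := le_trans hT (le_of_lt ht)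
    have ht0 : 0 < t := by linarith
    rw [Real.norm_eq_abs, abs_mul, abs_of_nonneg (Real.rpow_nonneg ht0.le _)]
    calc |partialSum c t - b * t ^ ρ| * t ^ (-l - 1) ≤ B * t ^ τ * t ^ (-l - 1) :=
          mul_le_mul_of_nonneg_right (hA t ht1) (Real.rpow_nonneg ht0.le _)
      _ = B * t ^ (τ - l - 1) := by
          rw [show τ - l - 1 = τ + (-l - 1) by ring, Real.rpow_add ht0]; ring
  have hgi : IntegrableOn (fun t : ℝ ↦ B * t ^ (τ - l - 1)) (Ioi T) :=
    (integrableOn_Ioi_rpow_of_lt (by linarith) hT0).const_mul B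
  have h1 : ‖∫ t in Ioi T, (partialSum c t - b * t ^ ρ) * t ^ (-l - 1)‖ ≤ ∫ t in Ioi T, B * t ^ (τ - l - 1) :=
    norm_integral_le_of_norm_le hgi (ae_restrict_of_forall_mem measurableSet_Ioi hbound)
  rw [Real.norm_eq_abs] at h1
  refine h1.trans (le_of_eq ?_)
  rw [integral_const_mul, integral_Ioi_rpow_of_lt (by linarith) hT0, show τ - l - 1 + 1 = τ - l by ring]
  have h2 : -T ^ (τ - l) / (τ - l) = T ^ (τ - l) / (l - τ) := by
    rw [neg_div, ← div_neg, neg_sub]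
  rw [h2, mul_div_assoc]

/-- If `|A(t) − b t^ρ| ≤ B t^τ` on `[1,∞)` then `0 ≤ B`. [folklore] -/
theorem nonneg_of_error_bound {b ρ τ B : ℝ}
    (hA : ∀ t, 1 ≤ t → |partialSum c t - b * t ^ ρ| ≤ B * t ^ τ) : 0 ≤ B := by
  have h := hA 1 le_rfl
  simp only [Real.one_rpow, mul_one] at h
  exact le_trans (abs_nonneg _) h

/-- From `|A(t) − b t^ρ| ≤ B t^τ` with `τ ≤ ρ`: `|A(t)| ≤ (|b| + B) t^ρ` on `[1, ∞)`. [folklore] -/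
theorem abs_partialSum_le_of_error_bound {b ρ τ B : ℝ} (hτρ : τ ≤ ρ)
    (hA : ∀ t, 1 ≤ t → |partialSum c t - b * t ^ ρ| ≤ B * t ^ τ) {t : ℝ} (ht : 1 ≤ t) :
    |partialSum c t| ≤ (|b| + B) * t ^ ρ := by
  have hB := nonneg_of_error_bound c hA
  have h := hA t ht
  have ht0 : 0 ≤ t := by linarith
  have h2 : B * t ^ τ ≤ B * t ^ ρ := mul_le_mul_of_nonneg_left (Real.rpow_le_rpow_of_exponent_le ht hτρ) hB
  calc |partialSum c t| = |(partialSum c t - b * t ^ ρ) + b * t ^ ρ| := by ring_nf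
    _ ≤ |partialSum c t - b * t ^ ρ| + |b * t ^ ρ| := abs_add_le _ _
    _ ≤ B * t ^ ρ + |b| * t ^ ρ := by rw [abs_mul, abs_of_nonneg (Real.rpow_nonneg ht0 _)]; linarith
    _ = (|b| + B) * t ^ ρ := by ring

/-! ### (AB1) Upper bound -/

/-- **Power-law partial summation, upper bound**: if `c ≥ 0`, `c 0 = 0`, `A(t) ≤ B t^ρ` for `t ≥ 1`
and `0 ≤ λ < ρ`, then `∑_{k ≤ T} c_k k^{−λ} ≤ B ρ/(ρ−λ) T^{ρ−λ}` for `T ≥ 1` (BDR, proof of Lemma 5.1: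
the bounds `x^δ ∑_{n ≤ y} O(n^{−δ}) = O(x^δ y^{1−δ})`, `x^γ ∑_{l ≤ x/y} h(l) O(l^{−γ}) = O(x^β y^{γ−β})`).
[cite: BrouckeDebruyneRevesz2023, Lemma 5.1 (proof)] -/
theorem sum_mul_rpow_neg_le (hc : c 0 = 0) (hc0 : ∀ k, 0 ≤ c k) {ρ l B : ℝ} (hl : 0 ≤ l) (hlρ : l < ρ)
    (hA : ∀ t, 1 ≤ t → partialSum c t ≤ B * t ^ ρ) {T : ℝ} (hT : 1 ≤ T) :
    ∑ k ∈ Finset.Icc 0 ⌊T⌋₊, c k * (k : ℝ) ^ (-l) ≤ B * (ρ / (ρ - l)) * T ^ (ρ - l) := by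
  have hT0 : 0 < T := by linarith
  have hρl : 0 < ρ - l := by linarith
  have hAnn : ∀ t, 0 ≤ partialSum c t := fun t ↦ Finset.sum_nonneg fun k _ ↦ hc0 k
  have hB : 0 ≤ B := by
    have h := hA 1 le_rfl
    rw [Real.one_rpow, mul_one] at h
    exact le_trans (hAnn 1) h
  rw [sum_mul_rpow_neg_eq c hc l T]
  -- first term
  have h1 : partialSum c T * T ^ (-l) ≤ B * T ^ (ρ - l) := by
    calc partialSum c T * T ^ (-l) ≤ B * T ^ ρ * T ^ (-l) :=
          mul_le_mul_of_nonneg_right (hA T hT) (Real.rpow_nonneg hT0.le _)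
      _ = B * T ^ (ρ - l) := by rw [show ρ - l = ρ + -l by ring, Real.rpow_add hT0]; ring
  -- integral term
  have hint : IntegrableOn (fun t : ℝ ↦ partialSum c t * t ^ (-l - 1)) (Ioc 1 T) :=
    integrableOn_partialSum_mul_rpow_Ioc c (-l - 1) T
  have hint2 : IntegrableOn (fun t : ℝ ↦ B * t ^ (ρ - l - 1)) (Ioc 1 T) :=
    (continuousOn_const_mul_rpow_of_pos B (ρ - l - 1) fun t ht ↦ pos_of_mem_Icc_one ht).integrableOn_Icc.mono_set
      Ioc_subset_Icc_self
  have h2 : ∫ t in Ioc 1 T, partialSum c t * t ^ (-l - 1) ≤ ∫ t in Ioc 1 T, B * t ^ (ρ - l - 1) := by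
    refine setIntegral_mono_on hint hint2 measurableSet_Ioc fun t ht ↦ ?_
    have ht0 : 0 < t := by linarith [ht.1]
    calc partialSum c t * t ^ (-l - 1) ≤ B * t ^ ρ * t ^ (-l - 1) :=
          mul_le_mul_of_nonneg_right (hA t ht.1.le) (Real.rpow_nonneg ht0.le _)
      _ = B * t ^ (ρ - l - 1) := by rw [show ρ - l - 1 = ρ + (-l - 1) by ring, Real.rpow_add ht0]; ring
  have h3 : ∫ t in Ioc 1 T, B * t ^ (ρ - l - 1) = B * ((T ^ (ρ - l) - 1) / (ρ - l)) := by
    rw [integral_const_mul, integral_Ioc_one_rpow (by linarith) hT, show ρ - l - 1 + 1 = ρ - l by ring]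
  have h4 : B * ((T ^ (ρ - l) - 1) / (ρ - l)) ≤ B * (T ^ (ρ - l) / (ρ - l)) := by
    refine mul_le_mul_of_nonneg_left ?_ hB
    exact div_le_div_of_nonneg_right (by linarith) hρl.le
  have h5 : l * ∫ t in Ioc 1 T, partialSum c t * t ^ (-l - 1) ≤ l * (B * (T ^ (ρ - l) / (ρ - l))) :=
    mul_le_mul_of_nonneg_left (h2.trans (h3.le.trans h4)) hl
  calc partialSum c T * T ^ (-l) + l * ∫ t in Ioc 1 T, partialSum c t * t ^ (-l - 1)
      ≤ B * T ^ (ρ - l) + l * (B * (T ^ (ρ - l) / (ρ - l))) := add_le_add h1 h5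
    _ = B * (ρ / (ρ - l)) * T ^ (ρ - l) := by field_simp; ring

/-! ### (AB2) Asymptotics with the constant term (linear density) -/

/-- BDR's constant `I(λ) = lim_R (∑_{k ≤ R} c_k k^{−λ} − a R^{1−λ}/(1−λ))`, in closed form
`λ ∫₁^∞ (A(t) − a t) t^{−λ−1} dt − aλ/(1−λ)`. [cite: BrouckeDebruyneRevesz2023, Lemma 5.1] -/
def abelConst (a l : ℝ) : ℝ :=
  l * (∫ t in Ioi 1, (partialSum c t - a * t) * t ^ (-l - 1)) - a * l / (1 - l)

/-- **Power-law partial summation with constant term**: if `c 0 = 0`, `|A(t) − a t| ≤ B t^τ` for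
`t ≥ 1` and `0 ≤ τ < λ < 1`, then for `T ≥ 1`
`|∑_{k ≤ T} c_k k^{−λ} − (a/(1−λ) T^{1−λ} + I)| ≤ B (1 + λ/(λ−τ)) T^{τ−λ}` with `I = abelConst c a λ`
(BDR, proof of Lemma 5.1: `b x^β ∑_{n ≤ y} n^{−β} = b x^β I(β) + ab x^β y^{1−β}/(1−β) + O(x^β y^{γ−β})`).
[cite: BrouckeDebruyneRevesz2023, Lemma 5.1 (proof)] -/
theorem abs_sum_mul_rpow_neg_sub_le (hc : c 0 = 0) {a l τ B : ℝ} (hτ : 0 ≤ τ) (hτl : τ < l) (hl1 : l < 1)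
    (hA : ∀ t, 1 ≤ t → |partialSum c t - a * t| ≤ B * t ^ τ) {T : ℝ} (hT : 1 ≤ T) :
    |∑ k ∈ Finset.Icc 0 ⌊T⌋₊, c k * (k : ℝ) ^ (-l) - (a / (1 - l) * T ^ (1 - l) + abelConst c a l)|
      ≤ B * (1 + l / (l - τ)) * T ^ (τ - l) := by
  have hT0 : 0 < T := by linarith
  have hl0 : 0 < l := lt_of_le_of_lt hτ hτl
  have hA' : ∀ t, 1 ≤ t → |partialSum c t - a * t ^ (1 : ℝ)| ≤ B * t ^ τ := fun t ht ↦ by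
    rw [Real.rpow_one]; exact hA t ht
  -- integrability of the error term on `(1, ∞)`
  have hE : IntegrableOn (fun t : ℝ ↦ (partialSum c t - a * t) * t ^ (-l - 1)) (Ioi 1) :=
    (integrableOn_error_mul_rpow c hτl hA').congr_fun (fun t _ ↦ by simp only [Real.rpow_one]) measurableSet_Ioi
  have hEintT : IntegrableOn (fun t : ℝ ↦ (partialSum c t - a * t) * t ^ (-l - 1)) (Ioc 1 T) :=
    hE.mono_set Ioc_subset_Ioi_self
  have hpow_int : IntegrableOn (fun t : ℝ ↦ a * t ^ (-l)) (Ioc 1 T) :=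
    (continuousOn_const_mul_rpow_of_pos a (-l) fun t ht ↦ pos_of_mem_Icc_one ht).integrableOn_Icc.mono_set
      Ioc_subset_Icc_self
  -- `∫ A w = a ∫ t^{-l} + ∫ E w` on `Ioc 1 T`
  have hsplit : ∫ t in Ioc 1 T, partialSum c t * t ^ (-l - 1) =
      a * ((T ^ (1 - l) - 1) / (1 - l)) + ∫ t in Ioc 1 T, (partialSum c t - a * t) * t ^ (-l - 1) := by
    have heq : ∀ t ∈ Ioc (1 : ℝ) T, partialSum c t * t ^ (-l - 1) =
        a * t ^ (-l) + (partialSum c t - a * t) * t ^ (-l - 1) := by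
      intro t ht
      have ht0 : 0 < t := by linarith [ht.1]
      have h1 : t * t ^ (-l - 1) = t ^ (-l) := by
        have h := Real.rpow_add ht0 1 (-l - 1)
        rw [Real.rpow_one, show (1 : ℝ) + (-l - 1) = -l by ring] at h
        exact h.symm
      calc partialSum c t * t ^ (-l - 1) = a * (t * t ^ (-l - 1)) + (partialSum c t - a * t) * t ^ (-l - 1) := by ring
        _ = _ := by rw [h1]
    rw [setIntegral_congr_fun measurableSet_Ioc heq, integral_add hpow_int hEintT, integral_const_mul,
      integral_Ioc_one_rpow (by linarith) hT, show -l + 1 = 1 - l by ring]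
  -- `∫_{Ioi 1} E w = ∫_{Ioc 1 T} E w + ∫_{Ioi T} E w`
  have hunion : ∫ t in Ioi 1, (partialSum c t - a * t) * t ^ (-l - 1) =
      (∫ t in Ioc 1 T, (partialSum c t - a * t) * t ^ (-l - 1)) +
        ∫ t in Ioi T, (partialSum c t - a * t) * t ^ (-l - 1) := by
    rw [← setIntegral_union (Set.Ioc_disjoint_Ioi le_rfl) measurableSet_Ioi hEintT
      (hE.mono_set (Ioi_subset_Ioi hT)), Ioc_union_Ioi_eq_Ioi hT]
  -- the tail bound
  have htail : |∫ t in Ioi T, (partialSum c t - a * t) * t ^ (-l - 1)| ≤ B * T ^ (τ - l) / (l - τ) := by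
    have h := abs_integral_Ioi_error_le c hτl hA' hT
    simp only [Real.rpow_one] at h
    exact h
  -- assemble
  rw [sum_mul_rpow_neg_eq c hc l T, hsplit]
  unfold abelConst
  rw [hunion]
  set J := ∫ t in Ioc 1 T, (partialSum c t - a * t) * t ^ (-l - 1) with hJ
  set K := ∫ t in Ioi T, (partialSum c t - a * t) * t ^ (-l - 1) with hK
  have hTT : T * T ^ (-l) = T ^ (1 - l) := by
    rw [show (1 - l : ℝ) = 1 + (-l) by ring, Real.rpow_add hT0, Real.rpow_one]
  have hET : |(partialSum c T - a * T) * T ^ (-l)| ≤ B * T ^ (τ - l) := by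
    rw [abs_mul, abs_of_nonneg (Real.rpow_nonneg hT0.le _)]
    calc |partialSum c T - a * T| * T ^ (-l) ≤ B * T ^ τ * T ^ (-l) :=
          mul_le_mul_of_nonneg_right (hA T hT) (Real.rpow_nonneg hT0.le _)
      _ = B * T ^ (τ - l) := by rw [show τ - l = τ + -l by ring, Real.rpow_add hT0]; ring
  have hl1' : (1 - l) ≠ 0 := by linarith
  have key : partialSum c T * T ^ (-l) + l * (a * ((T ^ (1 - l) - 1) / (1 - l)) + J) -
      (a / (1 - l) * T ^ (1 - l) + (l * (J + K) - a * l / (1 - l))) =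
      (partialSum c T - a * T) * T ^ (-l) - l * K := by
    have e1 : partialSum c T * T ^ (-l) = (partialSum c T - a * T) * T ^ (-l) + a * T ^ (1 - l) := by
      rw [← hTT]; ring
    rw [e1]
    field_simp
    ring
  rw [key]
  calc |(partialSum c T - a * T) * T ^ (-l) - l * K| ≤ |(partialSum c T - a * T) * T ^ (-l)| + |l * K| := abs_sub _ _
    _ ≤ B * T ^ (τ - l) + l * (B * T ^ (τ - l) / (l - τ)) := by
        rw [abs_mul l K, abs_of_pos hl0]
        exact add_le_add hET (mul_le_mul_of_nonneg_left htail hl0.le)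
    _ = B * (1 + l / (l - τ)) * T ^ (τ - l) := by
        have : (l - τ) ≠ 0 := by linarith
        field_simp

/-- The limit form of the constant: `∑_{k ≤ R} c_k k^{−λ} − a R^{1−λ}/(1−λ) → I` along the integers
(BDR: "`I(β) = lim_{R → ∞} (∑_{n ≤ R, n ∈ 𝒩} n^{−β} − aR^{1−β}/(1−β))`").
[cite: BrouckeDebruyneRevesz2023, Lemma 5.1] -/
theorem tendsto_sum_mul_rpow_neg_sub (hc : c 0 = 0) {a l τ B : ℝ} (hτ : 0 ≤ τ) (hτl : τ < l) (hl1 : l < 1)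
    (hA : ∀ t, 1 ≤ t → |partialSum c t - a * t| ≤ B * t ^ τ) :
    Tendsto (fun R : ℕ ↦ ∑ k ∈ Finset.Icc 0 R, c k * (k : ℝ) ^ (-l) - a / (1 - l) * (R : ℝ) ^ (1 - l))
      atTop (𝓝 (abelConst c a l)) := by
  rw [Metric.tendsto_atTop]
  intro ε hε
  have ht : Tendsto (fun R : ℝ ↦ B * (1 + l / (l - τ)) * R ^ (τ - l)) atTop (𝓝 0) := by
    have h := (tendsto_rpow_neg_atTop (y := l - τ) (by linarith)).const_mul (B * (1 + l / (l - τ)))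
    rw [mul_zero] at h
    refine h.congr fun R ↦ ?_
    rw [neg_sub]
  obtain ⟨X, hX⟩ := ((ht.comp tendsto_natCast_atTop_atTop).eventually (gt_mem_nhds hε)).exists_forall_of_atTop
  refine ⟨max X 1, fun R hR ↦ ?_⟩
  have hR1 : (1 : ℝ) ≤ R := by exact_mod_cast le_trans (le_max_right _ _) hR
  have h := abs_sum_mul_rpow_neg_sub_le c hc hτ hτl hl1 hA hR1
  rw [Nat.floor_natCast] at h
  rw [Real.dist_eq]
  have hXR := hX R (le_trans (le_max_left _ _) hR)
  simp only [Function.comp_apply] at hXR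
  calc |∑ k ∈ Finset.Icc 0 R, c k * (k : ℝ) ^ (-l) - a / (1 - l) * (R : ℝ) ^ (1 - l) - abelConst c a l|
      = |∑ k ∈ Finset.Icc 0 R, c k * (k : ℝ) ^ (-l) - (a / (1 - l) * (R : ℝ) ^ (1 - l) + abelConst c a l)| := by
        rw [sub_sub]
    _ ≤ B * (1 + l / (l - τ)) * (R : ℝ) ^ (τ - l) := h
    _ < ε := hXR

/-! ### (AB3) The tail of a convergent power-law sum -/

/-- **Power-law partial summation, the sum**: if `c ≥ 0`, `c 0 = 0`, `|A(t) − b t^ρ| ≤ B t^τ` for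
`t ≥ 1` and `0 ≤ τ < ρ < λ`, then `∑_k c_k k^{−λ}` converges, to `λ ∫₁^∞ A(t) t^{−λ−1} dt`.
[cite: BrouckeDebruyneRevesz2023, Lemma 5.1 (proof, `H(1) = ∑ h(l)/l`)] -/
theorem hasSum_mul_rpow_neg (hc : c 0 = 0) (hc0 : ∀ k, 0 ≤ c k) {b ρ τ l B : ℝ} (hτ : 0 ≤ τ)
    (hτρ : τ < ρ) (hρl : ρ < l) (hA : ∀ t, 1 ≤ t → |partialSum c t - b * t ^ ρ| ≤ B * t ^ τ) :
    HasSum (fun k ↦ c k * (k : ℝ) ^ (-l)) (l * ∫ t in Ioi 1, partialSum c t * t ^ (-l - 1)) := by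
  have hl0 : 0 < l := by linarith
  have hApow : ∀ t, 1 ≤ t → |partialSum c t| ≤ (|b| + B) * t ^ ρ := fun t ht ↦
    abs_partialSum_le_of_error_bound c hτρ.le hA ht
  -- apply Mathlib's limit form of Abel summation with `f t = t^{-l}`
  have hf_diff : ∀ t ∈ Ici (1 : ℝ), DifferentiableAt ℝ (fun t : ℝ ↦ t ^ (-l)) t := fun t ht ↦
    (Real.hasDerivAt_rpow_const (Or.inl (pos_of_mem_Ici_one ht).ne')).differentiableAt
  have hf_int : LocallyIntegrableOn (deriv (fun t : ℝ ↦ t ^ (-l))) (Ici 1) := by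
    rw [deriv_rpow_neg]
    exact (continuousOn_const_mul_rpow_of_pos (-l) (-l - 1) fun _ ht ↦ pos_of_mem_Ici_one ht).locallyIntegrableOn
      measurableSet_Ici
  have h_lim : Tendsto (fun n : ℕ ↦ (n : ℝ) ^ (-l) * ∑ k ∈ Finset.Icc 0 n, c k) atTop (𝓝 0) := by
    have hbd : ∀ n : ℕ, 1 ≤ n → |(n : ℝ) ^ (-l) * ∑ k ∈ Finset.Icc 0 n, c k| ≤ (|b| + B) * (n : ℝ) ^ (ρ - l) := by
      intro n hn
      have hn1 : (1 : ℝ) ≤ n := by exact_mod_cast hn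
      have hn0 : (0 : ℝ) < n := by linarith
      have h := hApow n hn1
      rw [show partialSum c n = ∑ k ∈ Finset.Icc 0 n, c k by simp [partialSum]] at h
      rw [abs_mul, abs_of_nonneg (Real.rpow_nonneg hn0.le _), mul_comm]
      calc |∑ k ∈ Finset.Icc 0 n, c k| * (n : ℝ) ^ (-l) ≤ (|b| + B) * (n : ℝ) ^ ρ * (n : ℝ) ^ (-l) :=
            mul_le_mul_of_nonneg_right h (Real.rpow_nonneg hn0.le _)
        _ = (|b| + B) * (n : ℝ) ^ (ρ - l) := by rw [show ρ - l = ρ + -l by ring, Real.rpow_add hn0]; ring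
    have ht : Tendsto (fun n : ℕ ↦ (|b| + B) * (n : ℝ) ^ (ρ - l)) atTop (𝓝 0) := by
      have h := ((tendsto_rpow_neg_atTop (y := l - ρ) (by linarith)).comp tendsto_natCast_atTop_atTop).const_mul (|b| + B)
      rw [mul_zero] at h
      refine h.congr fun n ↦ ?_
      simp only [Function.comp_apply, neg_sub]
    refine squeeze_zero_norm' ?_ ht
    filter_upwards [eventually_ge_atTop 1] with n hn
    rw [Real.norm_eq_abs]; exact hbd n hn
  have hg_dom : (fun t : ℝ ↦ deriv (fun t : ℝ ↦ t ^ (-l)) t * ∑ k ∈ Finset.Icc 0 ⌊t⌋₊, c k) =O[atTop]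
      fun t : ℝ ↦ t ^ (ρ - l - 1) := by
    simp only [deriv_rpow_neg]
    refine Asymptotics.IsBigO.of_bound (l * (|b| + B)) ?_
    filter_upwards [eventually_ge_atTop (1 : ℝ)] with t ht
    have ht0 : 0 < t := by linarith
    have h := hApow t ht
    rw [Real.norm_eq_abs, Real.norm_eq_abs, abs_of_nonneg (Real.rpow_nonneg ht0.le _), abs_mul, abs_mul,
      abs_neg, abs_of_pos hl0, abs_of_nonneg (Real.rpow_nonneg ht0.le _)]
    calc l * t ^ (-l - 1) * |∑ k ∈ Finset.Icc 0 ⌊t⌋₊, c k| ≤ l * t ^ (-l - 1) * ((|b| + B) * t ^ ρ) :=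
          mul_le_mul_of_nonneg_left h (mul_nonneg hl0.le (Real.rpow_nonneg ht0.le _))
      _ = l * (|b| + B) * t ^ (ρ - l - 1) := by
          rw [show ρ - l - 1 = ρ + (-l - 1) by ring, Real.rpow_add ht0]; ring
  have hmain := tendsto_sum_mul_atTop_nhds_one_sub_integral₀ c hc hf_diff hf_int h_lim hg_dom
    (integrableAtFilter_rpow_atTop (by linarith))
  simp only [deriv_rpow_neg, zero_sub] at hmain
  have hlim_eq : -∫ t in Ioi 1, -l * t ^ (-l - 1) * ∑ k ∈ Finset.Icc 0 ⌊t⌋₊, c k =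
      l * ∫ t in Ioi 1, partialSum c t * t ^ (-l - 1) := by
    rw [← integral_neg, ← integral_const_mul]
    refine setIntegral_congr_fun measurableSet_Ioi fun t _ ↦ ?_
    simp only [partialSum]; ring
  rw [hlim_eq] at hmain
  -- from the limit of the partial sums over `Icc 0 n` to `HasSum` (non-negative terms)
  have hnn : ∀ k, 0 ≤ c k * (k : ℝ) ^ (-l) := fun k ↦ mul_nonneg (hc0 k) (Real.rpow_nonneg (Nat.cast_nonneg k) _)
  rw [hasSum_iff_tendsto_nat_of_nonneg hnn]
  have h2 : Tendsto (fun n : ℕ ↦ ∑ i ∈ Finset.range (n + 1), c i * (i : ℝ) ^ (-l)) atTop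
      (𝓝 (l * ∫ t in Ioi 1, partialSum c t * t ^ (-l - 1))) := by
    refine hmain.congr fun n ↦ ?_
    rw [Nat.range_succ_eq_Icc_zero]
    exact Finset.sum_congr rfl fun k _ ↦ mul_comm _ _
  exact (Filter.tendsto_add_atTop_iff_nat 1).mp h2

/-- **The tail estimate**: under the hypotheses of `hasSum_mul_rpow_neg`, for `T ≥ 1` the tail
`∑_{k > T} c_k k^{−λ} = λ ∫₁^∞ A t^{−λ−1} − ∑_{k ≤ T} c_k k^{−λ}` satisfies
`|tail(T) − bρ/(λ−ρ) T^{ρ−λ}| ≤ B (1 + λ/(λ−τ)) T^{τ−λ}` (BDR, proof of Lemma 5.1: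
`ax ∑_{l ≤ x/y} h(l)/l = axH(1) − βab x^β y^{1−β}/(1−β) + O(x^δ y^{1−δ})`).
[cite: BrouckeDebruyneRevesz2023, Lemma 5.1 (proof)] -/
theorem abs_tail_sub_le (hc : c 0 = 0) {b ρ τ l B : ℝ} (hτ : 0 ≤ τ)
    (hτρ : τ < ρ) (hρl : ρ < l) (hA : ∀ t, 1 ≤ t → |partialSum c t - b * t ^ ρ| ≤ B * t ^ τ)
    {T : ℝ} (hT : 1 ≤ T) :
    |(l * ∫ t in Ioi 1, partialSum c t * t ^ (-l - 1)) - ∑ k ∈ Finset.Icc 0 ⌊T⌋₊, c k * (k : ℝ) ^ (-l)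
        - b * ρ / (l - ρ) * T ^ (ρ - l)| ≤ B * (1 + l / (l - τ)) * T ^ (τ - l) := by
  have hT0 : 0 < T := by linarith
  have hl0 : 0 < l := by linarith
  have hlρ : 0 < l - ρ := by linarith
  have hApow : ∀ t, 1 ≤ t → |partialSum c t| ≤ (|b| + B) * t ^ ρ := fun t ht ↦
    abs_partialSum_le_of_error_bound c hτρ.le hA ht
  have hAint : IntegrableOn (fun t : ℝ ↦ partialSum c t * t ^ (-l - 1)) (Ioi 1) :=
    integrableOn_partialSum_mul_rpow c hρl hApow
  have hE : IntegrableOn (fun t : ℝ ↦ (partialSum c t - b * t ^ ρ) * t ^ (-l - 1)) (Ioi 1) :=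
    integrableOn_error_mul_rpow c (lt_trans hτρ hρl) hA
  -- split `∫_{Ioi 1} = ∫_{Ioc 1 T} + ∫_{Ioi T}`
  have hunion : ∫ t in Ioi 1, partialSum c t * t ^ (-l - 1) =
      (∫ t in Ioc 1 T, partialSum c t * t ^ (-l - 1)) + ∫ t in Ioi T, partialSum c t * t ^ (-l - 1) := by
    rw [← setIntegral_union (Set.Ioc_disjoint_Ioi le_rfl) measurableSet_Ioi
      (hAint.mono_set Ioc_subset_Ioi_self) (hAint.mono_set (Ioi_subset_Ioi hT)), Ioc_union_Ioi_eq_Ioi hT]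
  -- on `Ioi T`: `∫ A w = b ∫ t^{ρ-l-1} + ∫ E w`
  have hpow_int : IntegrableOn (fun t : ℝ ↦ b * t ^ (ρ - l - 1)) (Ioi T) :=
    (integrableOn_Ioi_rpow_of_lt (by linarith) hT0).const_mul b
  have hEintT : IntegrableOn (fun t : ℝ ↦ (partialSum c t - b * t ^ ρ) * t ^ (-l - 1)) (Ioi T) :=
    hE.mono_set (Ioi_subset_Ioi hT)
  have hsplit : ∫ t in Ioi T, partialSum c t * t ^ (-l - 1) =
      b * (T ^ (ρ - l) / (l - ρ)) + ∫ t in Ioi T, (partialSum c t - b * t ^ ρ) * t ^ (-l - 1) := by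
    have heq : ∀ t ∈ Ioi T, partialSum c t * t ^ (-l - 1) =
        b * t ^ (ρ - l - 1) + (partialSum c t - b * t ^ ρ) * t ^ (-l - 1) := by
      intro t ht
      have ht0 : 0 < t := lt_of_lt_of_le hT0 (le_of_lt ht)
      have h1 : t ^ ρ * t ^ (-l - 1) = t ^ (ρ - l - 1) := by
        rw [show ρ - l - 1 = ρ + (-l - 1) by ring, Real.rpow_add ht0]
      calc partialSum c t * t ^ (-l - 1) = b * (t ^ ρ * t ^ (-l - 1)) + (partialSum c t - b * t ^ ρ) * t ^ (-l - 1) := by ring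
        _ = _ := by rw [h1]
    rw [setIntegral_congr_fun measurableSet_Ioi heq, integral_add hpow_int hEintT, integral_const_mul,
      integral_Ioi_rpow_of_lt (by linarith) hT0, show ρ - l - 1 + 1 = ρ - l by ring]
    have h2 : -T ^ (ρ - l) / (ρ - l) = T ^ (ρ - l) / (l - ρ) := by
      rw [neg_div, ← div_neg, neg_sub]
    rw [h2]
  have htail : |∫ t in Ioi T, (partialSum c t - b * t ^ ρ) * t ^ (-l - 1)| ≤ B * T ^ (τ - l) / (l - τ) :=
    abs_integral_Ioi_error_le c (lt_trans hτρ hρl) hA hT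
  -- assemble
  rw [hunion, sum_mul_rpow_neg_eq c hc l T, hsplit]
  set K := ∫ t in Ioi T, (partialSum c t - b * t ^ ρ) * t ^ (-l - 1) with hK
  set J := ∫ t in Ioc 1 T, partialSum c t * t ^ (-l - 1) with hJ
  have hTT : T ^ ρ * T ^ (-l) = T ^ (ρ - l) := by rw [show ρ - l = ρ + -l by ring, Real.rpow_add hT0]
  have hET : |(partialSum c T - b * T ^ ρ) * T ^ (-l)| ≤ B * T ^ (τ - l) := by
    rw [abs_mul, abs_of_nonneg (Real.rpow_nonneg hT0.le _)]
    calc |partialSum c T - b * T ^ ρ| * T ^ (-l) ≤ B * T ^ τ * T ^ (-l) :=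
          mul_le_mul_of_nonneg_right (hA T hT) (Real.rpow_nonneg hT0.le _)
      _ = B * T ^ (τ - l) := by rw [show τ - l = τ + -l by ring, Real.rpow_add hT0]; ring
  have key : l * (J + (b * (T ^ (ρ - l) / (l - ρ)) + K)) - (partialSum c T * T ^ (-l) + l * J) -
      b * ρ / (l - ρ) * T ^ (ρ - l) = l * K - (partialSum c T - b * T ^ ρ) * T ^ (-l) := by
    have e1 : partialSum c T * T ^ (-l) = (partialSum c T - b * T ^ ρ) * T ^ (-l) + b * T ^ (ρ - l) := by
      rw [← hTT]; ring
    rw [e1]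
    field_simp
    ring
  rw [key]
  calc |l * K - (partialSum c T - b * T ^ ρ) * T ^ (-l)| ≤ |l * K| + |(partialSum c T - b * T ^ ρ) * T ^ (-l)| :=
        abs_sub _ _
    _ ≤ l * (B * T ^ (τ - l) / (l - τ)) + B * T ^ (τ - l) := by
        rw [abs_mul l K, abs_of_pos hl0]
        exact add_le_add (mul_le_mul_of_nonneg_left htail hl0.le) hET
    _ = B * (1 + l / (l - τ)) * T ^ (τ - l) := by
        have : (l - τ) ≠ 0 := by linarith
        field_simp
        ring

end Literature.NumberTheory.BeurlingPrimes
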